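import Summits.CriticalPhenomena.Ising3DConformalLimit.Theses.FKParityRobustness
import Summits.CriticalPhenomena.Ising3DConformalLimit.Theorems.FKParityRobustnessDefs
import Summits.CriticalPhenomena.Ising3DConformalLimit.Theorems.FKParityRobustnessParityRobustMergingEvenSubgraphCount
import Summits.CriticalPhenomena.Ising3DConformalLimit.Theorems.FKParityRobustnessParityRobustMergingGrimmettJanson
import Summits.CriticalPhenomena.Ising3DConformalLimit.Theorems.FKParityRobustnessParityRobustMergingFKTransfer
import Literature.Probability.LatticeModels.LoopO1
import Literature.Probability.LatticeModels.RandomCluster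
import Literature.Probability.LatticeModels.RandomClusterFKG
import Literature.Probability.LatticeModels.FKIsingRSWProofs
import Literature.Combinatorics.SimpleGraph.CycleSpaceSeparators
import HarnessLib

/-!
# `SourceTrailsMeet` (stmt-CriticalPhenomena-11255) in FK dress: the loop-O(1) ⟷ FK-Ising dictionary
# and the reduction `ParityRobustMerging → FKFourConnectivity → SourceTrailsMeet`

Route `FKParityRobustness`, sub-problem `Ising3DConformalLimit`.  The support item `SourceTrailsMeet`
asks, for the sourced loop-O(1) sums `Z(S; P) = ∑ {t_c^{|F|} : F ⊆ E(Λ_N), ∂F = S, P F}` on the box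
`Λ_N ⊂ ℤ³` at `t_c = tanh β_c(3)` and the dilated tetrahedron `a = l • tetra`, for a constant `c > 0`
UNIFORM in `l ≥ 1` with `c · Z({a₀,a₁}) · Z({a₂,a₃}) ≤ Z(∅) · Z(A; all aᵢ in one component)`.

What is proved here (finite sums only, no limit is taken):

* the exact DICTIONARY between the loop side and the free FK-Ising measure
  `φ = rcMeasure G (fkIsingParam β) 2 ∅` of an arbitrary finite graph `G` at `β ≥ 0`, `t = tanh β`:
  - `rcPartitionFunction_two_eq` : `Z_RC = 2^{|V|} (1 − p/2)^{|E|} · Z_t(∅)`;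
  - `rcMeasure_real_openConn_eq` : `φ[x ↔ y] = Z_t({x,y}) / Z_t(∅)` (`x ≠ y`);
  - `integral_tJoinsRatio_eq` : `∫ u_a dφ = Z_t(A; all joined) / Z_t(∅)`, `u_a` the parity robustness;
  all three are instances of the sourced Grimmett–Janson identity `grimmettJanson_identity` (landed for
  the crux `ParityRobustMerging`) fed with the even-subgraph count `card_evenSubgraphs_mul_two_pow`, the
  switching count `card_tJoins_eq_card_evenSubgraphs` and the existence criterion
  `tJoins_pair_nonempty_iff` (`𝒯_{xy}(ω) ≠ ∅ ↔ x ↔ y` in `ω`: a path one way, the handshake lemma in a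
  component the other way);
* `sourceTrailsMeet_iff_fkMerged` : `SourceTrailsMeet` is EQUIVALENT to the merged FK statement
  `∃ c > 0, ∀ l ≥ 1, ∃ N₀, ∀ N ≥ N₀, ∀ a = l • tetra, c · φ_N[a₀↔a₁] · φ_N[a₂↔a₃] ≤ ∫ u_a dφ_N`
  (the conclusion of `ParityRobustMerging ∧ FKFourConnectivity`, with the same constant);
* `sourceTrailsMeet_of_parityRobustMerging_of_fkFourConnectivity` :
  `ParityRobustMerging → FKFourConnectivity → SourceTrailsMeet` (constant `c_B · c_P`);
* `connectedFour_le_of_sourceTrailsMeet_of_parityBound` : with `ParityBound`, the item gives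
  `U₄^free_{Λ_N}(a) ≤ −2c φ_N[a₀↔a₁] φ_N[a₂↔a₃]` in every large box (the FK-level lattice `U₄` bound).
So the item is EXACTLY the bottom rung `BLOB ∧ P4` of the route read on the loop side: it inherits their
status (both cruxes open: no RSW / gluing for critical FK-Ising on `ℤ³`) and implies pointwise
non-Gaussianity of critical 3D Ising (clause (iii)) — hence no unconditional proof is offered here.
Theorem-only file (no new definitions).  References: Grimmett–Janson, *Random even graphs*, Electron.
J. Combin. 16 (2009), Thm 3.1 [GrimmettJanson2007]; Hansen–Jiang–Klausen, arXiv:2506.10765, §2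
[HansenJiangKlausen2025]; Aizenman, Comm. Math. Phys. 86 (1982) [AizenmanCMP1982].
-/

noncomputable section

open MeasureTheory Finset SimpleGraph
open Literature.Probability.LatticeModels
open Literature.Probability.Percolation
open Literature.Combinatorics.SimpleGraph.CycleSpace
open Summit.CriticalPhenomena.Ising3DConformalLimit.Cruxes.ParityRobustMerging.PlaquetteXorSurgery

namespace Summit.CriticalPhenomena.Ising3DConformalLimit.Theorems

open scoped Classical

section General

variable {V : Type*} [Fintype V] [DecidableEq V] (G : SimpleGraph V) [DecidableRel G.Adj]

/-- The sourced loop-O(1) partition function as a sum over the `T`-joins of the source set: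
`Z_t(S) = ∑_{F ∈ 𝒯_S(G)} t^{|F|}` (unfolding of `loopO1PartitionFunction`/`loopO1Weight`). [folklore] -/
theorem loopO1PartitionFunction_eq_sum_tJoins (t : ℝ) (S : Finset V) :
    loopO1PartitionFunction G t S = ∑ F ∈ tJoins G Set.univ S, t ^ #F := by
  unfold loopO1PartitionFunction loopO1Weight
  rw [← Finset.sum_filter]
  refine Finset.sum_congr ?_ fun _ _ => rfl
  ext F
  simp only [Finset.mem_filter, Finset.mem_powerset]
  constructor
  · rintro ⟨-, h⟩
    exact h
  · intro h
    exact ⟨((mem_tJoins G).1 h).1, h⟩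

/-- The item's inlined sum `∑ {t^{|F|} : F ⊆ E(G), (∀ v, Odd deg_F v ↔ v ∈ S) ∧ P F}` is the loop-O(1)
mass of the `T`-joins of `S` satisfying `P` (the tree's `tJoins` carries the extra trivially true
conjunct `↑F ⊆ Set.univ`). [folklore] -/
theorem sum_powerset_filter_parity_eq (t : ℝ) (S : Finset V) (P : Finset (Sym2 V) → Prop) :
    ∑ F ∈ G.edgeFinset.powerset.filter
        (fun F => (∀ v, Odd (F.filter (fun e => v ∈ e)).card ↔ v ∈ S) ∧ P F), t ^ F.card =
      ∑ F ∈ (tJoins G Set.univ S).filter (fun F => P F), t ^ #F := by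
  refine Finset.sum_congr ?_ fun _ _ => rfl
  ext F
  simp only [Finset.mem_filter, Finset.mem_powerset, mem_tJoins, Set.subset_univ, true_and, and_assoc]

/-- **`T`-joins of a pair exist iff the pair is joined** [folklore]: for `ω ⊆ E(G)` and `x ≠ y`,
`𝒯_{x,y}(ω) ≠ ∅ ↔ x ↔ y` in the graph spanned by `ω`.  (`⇐`: the edge set of an `x`–`y` path has
odd degree exactly at `x, y`; `⇒`: by the handshake lemma in the component of `x`, the odd vertex
`x` of `F ∈ 𝒯_{x,y}(ω)` is joined inside `F ⊆ ω` to another odd vertex, which can only be `y`.) -/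
theorem tJoins_pair_nonempty_iff {ω : Finset (Sym2 V)} (hω : ω ⊆ G.edgeFinset) {x y : V}
    (hxy : x ≠ y) :
    (tJoins G (↑ω : Set (Sym2 V)) {x, y}).Nonempty ↔
      (fromEdgeSet (↑ω : Set (Sym2 V))).Reachable x y := by
  constructor
  · rintro ⟨F, hF⟩
    rw [mem_tJoins] at hF
    obtain ⟨hFG, hFω, hpar⟩ := hF
    have hdiag : ∀ e ∈ F, ¬e.IsDiag := fun e he =>
      G.not_isDiag_of_mem_edgeSet (mem_edgeFinset.1 (hFG he))
    have hx : Odd (edgeDeg F x) := (hpar x).2 (Finset.mem_insert_self x {y})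
    obtain ⟨w, hwx, hreach, hw⟩ := exists_reachable_odd_of_odd F hdiag hx
    have hw' : w ∈ ({x, y} : Finset V) := (hpar w).1 hw
    have hwy : w = y := by
      rcases Finset.mem_insert.1 hw' with h | h
      · exact absurd h hwx
      · exact Finset.mem_singleton.1 h
    subst hwy
    exact hreach.mono (fromEdgeSet_mono hFω)
  · rintro ⟨p⟩
    have hsub : ∀ e ∈ walkEdges (p.toPath : (fromEdgeSet (↑ω : Set (Sym2 V))).Walk x y), e ∈ ω := by
      intro e he
      have h := mem_edgeSet_of_mem_walkEdges _ he
      rw [edgeSet_fromEdgeSet] at h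
      exact Finset.mem_coe.1 h.1
    refine ⟨walkEdges (p.toPath : (fromEdgeSet (↑ω : Set (Sym2 V))).Walk x y), ?_⟩
    rw [mem_tJoins]
    refine ⟨fun e he => hω (hsub e he), fun e he => Finset.mem_coe.2 (hsub e (Finset.mem_coe.1 he)),
      fun w => ?_⟩
    show Odd (edgeDeg _ w) ↔ _
    rw [odd_edgeDeg_walkEdges_iff p.toPath.2 hxy w, Finset.mem_insert, Finset.mem_singleton]

/-- The Grimmett–Janson ratio of a PAIR source set is the connection indicator [folklore]:
`#𝒯_{x,y}(ω) / #𝓔_∅(ω) = 1[x ↔ y in ω]` (switching count `card_tJoins_eq_card_evenSubgraphs` when a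
`T`-join exists, `tJoins_pair_nonempty_iff` for when it does). -/
theorem card_tJoins_pair_div_card_evenSubgraphs {ω : Finset (Sym2 V)} (hω : ω ⊆ G.edgeFinset)
    {x y : V} (hxy : x ≠ y) :
    (#(tJoins G (↑ω : Set (Sym2 V)) {x, y}) : ℝ) / (#(evenSubgraphs G (↑ω : Set (Sym2 V))) : ℝ) =
      if (fromEdgeSet (↑ω : Set (Sym2 V))).Reachable x y then 1 else 0 := by
  have hE : (#(evenSubgraphs G (↑ω : Set (Sym2 V))) : ℝ) ≠ 0 :=
    Nat.cast_ne_zero.2 (Finset.card_pos.2 ⟨∅, empty_mem_evenSubgraphs G _⟩).ne'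
  split_ifs with h
  · obtain ⟨F₀, hF₀⟩ := (tJoins_pair_nonempty_iff G hω hxy).2 h
    rw [card_tJoins_eq_card_evenSubgraphs G hF₀, div_self hE]
  · rw [Finset.not_nonempty_iff_eq_empty.1 (mt (tJoins_pair_nonempty_iff G hω hxy).1 h),
      Finset.card_empty, Nat.cast_zero, zero_div]

/-- **FK-Ising partition function in loop dress** [cite: GrimmettJanson2007, Thm 3.1]: for
`p ∈ [0,1]`, `Z_RC(G; p, 2, free) = 2^{|V|} (1 − p/2)^{|E|} · ∑_{F ∈ 𝓔_∅(G)} (p/(2−p))^{|F|}` — the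
Grimmett–Janson identity at `A = ∅`, `P = ⊤`, where the ratio `#𝒯_∅(ω)/#𝓔_∅(ω)` is `1`. -/
theorem rcPartitionFunction_two_eq {p : ℝ} (hp : p ∈ Set.Icc (0 : ℝ) 1) :
    rcPartitionFunction G p 2 ∅ =
      2 ^ Fintype.card V * (1 - p / 2) ^ #G.edgeFinset *
        ∑ F ∈ tJoins G Set.univ ∅, (p / (2 - p)) ^ #F := by
  have hGJ := grimmettJanson_identity G (card_evenSubgraphs_mul_two_pow G) hp ∅ (fun _ => True)
  simp only [Finset.filter_true] at hGJ
  rw [← hGJ]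
  unfold rcPartitionFunction
  refine Finset.sum_congr rfl fun ω _ => ?_
  have hE : (#(evenSubgraphs G (↑ω : Set (Sym2 V))) : ℝ) ≠ 0 :=
    Nat.cast_ne_zero.2 (Finset.card_pos.2 ⟨∅, empty_mem_evenSubgraphs G _⟩).ne'
  rw [show tJoins G (↑ω : Set (Sym2 V)) ∅ = evenSubgraphs G (↑ω : Set (Sym2 V)) from rfl,
    div_self hE, mul_one]

/-- The sourceless loop-O(1) partition function at the FK-Ising weight is positive:
`Z_{tanh β}(∅) > 0` for `β ≥ 0`. [folklore] -/
theorem loopO1PartitionFunction_tanh_empty_pos {β : ℝ} (hβ : 0 ≤ β) :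
    0 < loopO1PartitionFunction G (Real.tanh β) ∅ := by
  refine loopO1PartitionFunction_empty_pos G ?_
  rw [Real.tanh_eq_sinh_div_cosh]
  exact div_nonneg (Real.sinh_nonneg_iff.2 hβ) (Real.cosh_pos _).le

/-- **The FK two-point function in loop dress** [cite: GrimmettJanson2007, Thm 3.1] (with the
high-temperature expansion, Hansen–Jiang–Klausen 2025 §2): for `β ≥ 0`, `p = 1 − e^{−2β}`,
`t = tanh β` and `x ≠ y`,
`φ_{G,p,2}[x ↔ y] = Z_t({x,y}) / Z_t(∅)`.
Proof: `φ[x ↔ y] = Z_RC⁻¹ ∑_ω w(ω) · #𝒯_{xy}(ω)/#𝓔_∅(ω)` by `card_tJoins_pair_div_card_evenSubgraphs`,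
then the Grimmett–Janson identity at `A = {x,y}` and `rcPartitionFunction_two_eq`. -/
theorem rcMeasure_real_openConn_eq {β : ℝ} (hβ : 0 ≤ β) {x y : V} (hxy : x ≠ y) :
    (rcMeasure G (fkIsingParam β) 2 ∅).real (openConn x y) =
      (∑ F ∈ tJoins G Set.univ {x, y}, Real.tanh β ^ #F) /
        loopO1PartitionFunction G (Real.tanh β) ∅ := by
  have hp : fkIsingParam β ∈ Set.Icc (0 : ℝ) 1 := fkIsingParam_mem_Icc hβ
  have ht : Real.tanh β = fkIsingParam β / (2 - fkIsingParam β) := tanh_eq_fkIsingParam_div β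
  have hGJ := grimmettJanson_identity G (card_evenSubgraphs_mul_two_pow G) hp {x, y} (fun _ => True)
  simp only [Finset.filter_true] at hGJ
  have hK : (2 : ℝ) ^ Fintype.card V * (1 - fkIsingParam β / 2) ^ #G.edgeFinset ≠ 0 := by
    have : 0 < 1 - fkIsingParam β / 2 := by linarith [hp.2]
    positivity
  have step : ∀ ω ∈ G.edgeFinset.powerset,
      (if (↑ω : BondConfig V) ∈ openConn x y then
          rcWeight G (fkIsingParam β) 2 ∅ ω / rcPartitionFunction G (fkIsingParam β) 2 ∅ else 0) =
        rcWeight G (fkIsingParam β) 2 ∅ ω *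
            ((#(tJoins G (↑ω : Set (Sym2 V)) {x, y}) : ℝ) / (#(evenSubgraphs G (↑ω : Set (Sym2 V))) : ℝ)) /
          rcPartitionFunction G (fkIsingParam β) 2 ∅ := by
    intro ω hω
    rw [card_tJoins_pair_div_card_evenSubgraphs G (Finset.mem_powerset.1 hω) hxy]
    by_cases h : (fromEdgeSet (↑ω : Set (Sym2 V))).Reachable x y
    · have h' : (↑ω : BondConfig V) ∈ openConn x y := h
      rw [if_pos h', if_pos h, mul_one]
    · have h' : (↑ω : BondConfig V) ∉ openConn x y := h
      rw [if_neg h', if_neg h, mul_zero, zero_div]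
  rw [rcMeasure_real_apply G hp two_pos ∅ (openConn x y), Finset.sum_congr rfl step, ← Finset.sum_div,
    hGJ, rcPartitionFunction_two_eq G hp, loopO1PartitionFunction_eq_sum_tJoins, ht,
    mul_div_mul_left _ _ hK]

/-- **The parity robustness in loop dress** [cite: GrimmettJanson2007, Thm 3.1] (sourced form,
Hansen–Jiang–Klausen 2025 §2): for `β ≥ 0`, `t = tanh β` and four marked vertices `a`, the
`φ_{G,p,2}`-expectation of the fraction of `T`-joins of `A = {aᵢ}` inside `ω` keeping `A` in one
component is `Z_t(A; all joined) / Z_t(∅)` (`zMass` of `JoinsAll`).  Proof: `#𝒯_A(ω) = #𝓔_∅(ω)`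
whenever non-empty (switching count), the Grimmett–Janson identity at `P = JoinsAll a`, and
`rcPartitionFunction_two_eq`. -/
theorem integral_tJoinsRatio_eq {β : ℝ} (hβ : 0 ≤ β) (a : Fin 4 → V) :
    ∫ ω, (#((tJoins G ω (univ.image a)).filter fun F => JoinsAll a F) : ℝ) /
        (#(tJoins G ω (univ.image a)) : ℝ) ∂(rcMeasure G (fkIsingParam β) 2 ∅) =
      zMass G (Real.tanh β) a (fun F => JoinsAll a F) / loopO1PartitionFunction G (Real.tanh β) ∅ := by
  have hp : fkIsingParam β ∈ Set.Icc (0 : ℝ) 1 := fkIsingParam_mem_Icc hβ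
  have ht : Real.tanh β = fkIsingParam β / (2 - fkIsingParam β) := tanh_eq_fkIsingParam_div β
  have hGJ := grimmettJanson_identity G (card_evenSubgraphs_mul_two_pow G) hp (univ.image a)
    (fun F => JoinsAll a F)
  have hK : (2 : ℝ) ^ Fintype.card V * (1 - fkIsingParam β / 2) ^ #G.edgeFinset ≠ 0 := by
    have : 0 < 1 - fkIsingParam β / 2 := by linarith [hp.2]
    positivity
  have step : ∀ ω ∈ G.edgeFinset.powerset,
      rcWeight G (fkIsingParam β) 2 ∅ ω / rcPartitionFunction G (fkIsingParam β) 2 ∅ *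
          ((#((tJoins G (↑ω : Set (Sym2 V)) (univ.image a)).filter fun F => JoinsAll a F) : ℝ) /
            (#(tJoins G (↑ω : Set (Sym2 V)) (univ.image a)) : ℝ)) =
        rcWeight G (fkIsingParam β) 2 ∅ ω *
            ((#((tJoins G (↑ω : Set (Sym2 V)) (univ.image a)).filter fun F => JoinsAll a F) : ℝ) /
              (#(evenSubgraphs G (↑ω : Set (Sym2 V))) : ℝ)) /
          rcPartitionFunction G (fkIsingParam β) 2 ∅ := by
    intro ω _
    rcases (tJoins G (↑ω : Set (Sym2 V)) (univ.image a)).eq_empty_or_nonempty with hemp | ⟨F₀, hF₀⟩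
    · rw [hemp, Finset.filter_empty, Finset.card_empty, Nat.cast_zero, zero_div, zero_div, mul_zero,
        mul_zero, zero_div]
    · rw [card_tJoins_eq_card_evenSubgraphs G hF₀]
      ring
  rw [integral_rcMeasure G hp two_pos ∅, Finset.sum_congr rfl step, ← Finset.sum_div, hGJ,
    rcPartitionFunction_two_eq G hp, loopO1PartitionFunction_eq_sum_tJoins, zMass, ht,
    mul_div_mul_left _ _ hK]

end General

/-! ### The box: `SourceTrailsMeet` is the merged FK statement `BLOB ∧ P4` read on the loop side -/

section Box

open Summit.CriticalPhenomena.Ising3DConformalLimit.Theses.FKParityRobustness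

/-- **`SourceTrailsMeet` in FK dress** [cite: GrimmettJanson2007, Thm 3.1]: the item is EQUIVALENT,
with the same constant `c` and the same `N₀(l)`, to the merged conclusion of the two cruxes
`ParityRobustMerging` (BLOB) and `FKFourConnectivity` (P4):
`∃ c > 0, ∀ l ≥ 1, ∃ N₀, ∀ N ≥ N₀, ∀ a = l • tetra ⊂ Λ_N, c · φ_N[a₀ ↔ a₁] · φ_N[a₂ ↔ a₃] ≤ ∫ u_a dφ_N`,
`φ_N` the free FK-Ising measure of the box graph at `p = 1 − e^{−2β_c}` and `u_a` the parity
robustness.  Per configuration of sources this is the dictionary `φ[aᵢ ↔ aⱼ] = Z({aᵢ,aⱼ})/Z(∅)`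
(`rcMeasure_real_openConn_eq`), `∫ u_a dφ = Z(A; all joined)/Z(∅)` (`integral_tJoinsRatio_eq`) and
`Z(∅) > 0`, after which both inequalities are `c · Z({a₀,a₁}) Z({a₂,a₃}) ≤ Z(∅) Z(A; all joined)`
divided, or not, by `Z(∅)²`. -/
theorem sourceTrailsMeet_iff_fkMerged :
    SourceTrailsMeet ↔
    (let tetra : Fin 4 → Literature.Probability.LatticeModels.Site 3 := ![![-1, -1, -1], ![1, 1, -1], ![1, -1, 1], ![-1, 1, 1]]; ∃ c : ℝ, 0 < c ∧ ∀ l : ℕ, 1 ≤ l → ∃ N₀ : ℕ, ∀ N : ℕ, N₀ ≤ N → ∀ a : Fin 4 → ↥(Literature.Probability.LatticeModels.box 3 N), (∀ i, ((a i : Literature.Probability.LatticeModels.Site 3)) = (l : ℤ) • tetra i) → (let G := ((Literature.Probability.LatticeModels.zdGraph 3).comap (Subtype.val : ↥(Literature.Probability.LatticeModels.box 3 N) → Literature.Probability.LatticeModels.Site 3)); let φ := Literature.Probability.LatticeModels.rcMeasure G (Literature.Probability.LatticeModels.fkIsingParam (Literature.Probability.LatticeModels.criticalBeta 3)) 2 ∅;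 let sol : Set (Sym2 ↥(Literature.Probability.LatticeModels.box 3 N)) → Finset (Finset (Sym2 ↥(Literature.Probability.LatticeModels.box 3 N))) := fun ω => G.edgeFinset.powerset.filter (fun F => (↑F : Set (Sym2 ↥(Literature.Probability.LatticeModels.box 3 N))) ⊆ ω ∧ ∀ v, Odd (F.filter (fun e => v ∈ e)).card ↔ v ∈ Finset.univ.image a); let u : Set (Sym2 ↥(Literature.Probability.LatticeModels.box 3 N)) → ℝ := fun ω => (((sol ω).filter (fun F => ∀ i j, (SimpleGraph.fromEdgeSet (↑F : Set (Sym2 ↥(Literature.Probability.LatticeModels.box 3 N)))).Reachable (a i) (a j))).card : ℝ) / ((sol ω).card : ℝ); c * φ.real (Literature.Probability.Percolation.openConn (a 0) (a 1)) * φ.real (Literature.Probability.Percolation.openConn (a 2) (a 3)) ≤ ∫ ω, u ω ∂φ)) := by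
  unfold SourceTrailsMeet
  refine exists_congr fun c => and_congr_right fun _ => forall₂_congr fun l hl =>
    exists_congr fun N₀ => forall₂_congr fun N _ => forall₂_congr fun a ha => ?_
  have hainj : Function.Injective a := tetra_injective hl a ha
  have h01 : a 0 ≠ a 1 := hainj.ne (by decide)
  have h23 : a 2 ≠ a 3 := hainj.ne (by decide)
  have hβ : 0 ≤ criticalBeta 3 := criticalBeta_nonneg 3
  set Z0 : ℝ := loopO1PartitionFunction (boxGraph N) tc ∅ with hZ0_def
  set Z01 : ℝ := ∑ F ∈ tJoins (boxGraph N) Set.univ {a 0, a 1}, tc ^ #F with hZ01_def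
  set Z23 : ℝ := ∑ F ∈ tJoins (boxGraph N) Set.univ {a 2, a 3}, tc ^ #F with hZ23_def
  set ZA : ℝ := zMass (boxGraph N) tc a (fun F => JoinsAll a F) with hZA_def
  have hZ0 : 0 < Z0 := loopO1PartitionFunction_tanh_empty_pos _ hβ
  have key : c * (Z01 / Z0) * (Z23 / Z0) ≤ ZA / Z0 ↔ c * Z01 * Z23 ≤ Z0 * ZA := by
    rw [show c * (Z01 / Z0) * (Z23 / Z0) = c * Z01 * Z23 / (Z0 * Z0) by field_simp,
      show ZA / Z0 = Z0 * ZA / (Z0 * Z0) by field_simp, div_le_div_iff_of_pos_right (mul_pos hZ0 hZ0)]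
  constructor
  · intro h G φ sol u
    extract_lets E t Z at h
    have hZ : ∀ (S : Finset ↥(box 3 N)) (P : Finset (Sym2 ↥(box 3 N)) → Prop),
        Z S P = ∑ F ∈ (tJoins (boxGraph N) Set.univ S).filter (fun F => P F), tc ^ #F := by
      intro S P
      simp only [Z, E, t]
      exact sum_powerset_filter_parity_eq _ _ S P
    rw [hZ, hZ, hZ, hZ, Finset.filter_true, Finset.filter_true, Finset.filter_true,
      ← loopO1PartitionFunction_eq_sum_tJoins (boxGraph N) tc ∅, ← hZ01_def, ← hZ23_def,
      ← hZ0_def] at h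
    have hsol : ∀ ω, sol ω = tJoins G ω (univ.image a) := fun ω => rfl
    have hu : ∀ ω, u ω = (#((tJoins G ω (univ.image a)).filter fun F => JoinsAll a F) : ℝ) /
        (#(tJoins G ω (univ.image a)) : ℝ) := by
      intro ω
      simp only [u]
      rw [hsol ω, card_filter_bind_pure_coe _ _ (fun F => JoinsAll a F) (fun F => Iff.rfl)]
    have hint : ∫ ω, u ω ∂φ = ZA / Z0 := by
      rw [show u = fun ω => (#((tJoins G ω (univ.image a)).filter fun F => JoinsAll a F) : ℝ) /
          (#(tJoins G ω (univ.image a)) : ℝ) from funext hu]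
      exact integral_tJoinsRatio_eq G hβ a
    have hφ01 : φ.real (openConn (a 0) (a 1)) = Z01 / Z0 := rcMeasure_real_openConn_eq G hβ h01
    have hφ23 : φ.real (openConn (a 2) (a 3)) = Z23 / Z0 := rcMeasure_real_openConn_eq G hβ h23
    rw [hφ01, hφ23, hint, key, hZA_def]
    unfold zMass
    refine h.trans_eq ?_
    congr 1
  · intro h E t Z
    extract_lets G φ sol u at h
    have hZ : ∀ (S : Finset ↥(box 3 N)) (P : Finset (Sym2 ↥(box 3 N)) → Prop),
        Z S P = ∑ F ∈ (tJoins (boxGraph N) Set.univ S).filter (fun F => P F), tc ^ #F := by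
      intro S P
      simp only [Z, E, t]
      exact sum_powerset_filter_parity_eq _ _ S P
    rw [hZ, hZ, hZ, hZ, Finset.filter_true, Finset.filter_true, Finset.filter_true,
      ← loopO1PartitionFunction_eq_sum_tJoins (boxGraph N) tc ∅, ← hZ01_def, ← hZ23_def,
      ← hZ0_def]
    have hsol : ∀ ω, sol ω = tJoins G ω (univ.image a) := fun ω => rfl
    have hu : ∀ ω, u ω = (#((tJoins G ω (univ.image a)).filter fun F => JoinsAll a F) : ℝ) /
        (#(tJoins G ω (univ.image a)) : ℝ) := by
      intro ω
      simp only [u]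
      rw [hsol ω, card_filter_bind_pure_coe _ _ (fun F => JoinsAll a F) (fun F => Iff.rfl)]
    have hint : ∫ ω, u ω ∂φ = ZA / Z0 := by
      rw [show u = fun ω => (#((tJoins G ω (univ.image a)).filter fun F => JoinsAll a F) : ℝ) /
          (#(tJoins G ω (univ.image a)) : ℝ) from funext hu]
      exact integral_tJoinsRatio_eq G hβ a
    have hφ01 : φ.real (openConn (a 0) (a 1)) = Z01 / Z0 := rcMeasure_real_openConn_eq G hβ h01
    have hφ23 : φ.real (openConn (a 2) (a 3)) = Z23 / Z0 := rcMeasure_real_openConn_eq G hβ h23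
    rw [hφ01, hφ23, hint, key, hZA_def] at h
    unfold zMass at h
    refine h.trans_eq ?_
    congr 1

/-- **Reduction to the two cruxes**: `ParityRobustMerging → FKFourConnectivity → SourceTrailsMeet`,
with constant `c_B · c_P` and `N₀ = max(N_B, N_P)` — chain `c_P φ[a₀↔a₁]φ[a₂↔a₃] ≤ φ[all joined]` (P4)
and `c_B φ[all joined] ≤ ∫ u_a dφ` (BLOB), then `sourceTrailsMeet_iff_fkMerged`.  This is the
formal content of the route's remark that the item is "X4 in loop dress" (the bottom rung
`BLOB ∧ P4`); both antecedents are open cruxes of the route. [cite: GrimmettJanson2007, Thm 3.1] -/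
theorem sourceTrailsMeet_of_parityRobustMerging_of_fkFourConnectivity :
    ParityRobustMerging → FKFourConnectivity → SourceTrailsMeet := by
  intro hB hP
  rw [sourceTrailsMeet_iff_fkMerged]
  unfold ParityRobustMerging at hB
  unfold FKFourConnectivity at hP
  intro tetra
  obtain ⟨cB, hcB, hB⟩ := hB
  obtain ⟨cP, hcP, hP⟩ := hP
  refine ⟨cB * cP, mul_pos hcB hcP, fun l hl => ?_⟩
  obtain ⟨NB, hB⟩ := hB l hl
  obtain ⟨NP, hP⟩ := hP l hl
  refine ⟨max NB NP, fun N hN a ha => ?_⟩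
  have hB := hB N ((le_max_left _ _).trans hN) a ha
  have hP := hP N ((le_max_right _ _).trans hN) a ha
  intro G φ sol u
  have hP' : cP * φ.real (openConn (a 0) (a 1)) * φ.real (openConn (a 2) (a 3)) ≤
      φ.real {ω | ∀ i j, (openGraph ω).Reachable (a i) (a j)} := hP
  have hB' : cB * φ.real {ω | ∀ i j, (openGraph ω).Reachable (a i) (a j)} ≤ ∫ ω, u ω ∂φ := hB
  calc cB * cP * φ.real (openConn (a 0) (a 1)) * φ.real (openConn (a 2) (a 3))
      = cB * (cP * φ.real (openConn (a 0) (a 1)) * φ.real (openConn (a 2) (a 3))) := by ring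
    _ ≤ cB * φ.real {ω | ∀ i j, (openGraph ω).Reachable (a i) (a j)} :=
        mul_le_mul_of_nonneg_left hP' hcB.le
    _ ≤ ∫ ω, u ω ∂φ := hB'

/-- **What the item gives the assembly** (FK level, every finite box): `SourceTrailsMeet → ParityBound →`
for some `c > 0`, all `l ≥ 1`, all large `N` and `a = l • tetra ⊂ Λ_N`,
`U₄^free_{Λ_N}(a) ≤ −2c · φ_N[a₀ ↔ a₁] · φ_N[a₂ ↔ a₃]` — the FK-level lattice inequality that the
route's glue extracts from `ParityRobustMerging ∧ FKFourConnectivity ∧ ParityBound`, here from the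
single item (`sourceTrailsMeet_iff_fkMerged.mp` chained with `ParityBound`).  Through Edwards–Sokal
and the box limit this is `|U₄(A_l)| ≥ 2c ⟨σσ⟩⟨σσ⟩` at `β_c(ℤ³)` uniformly in `l`, i.e. the item implies
pointwise non-Gaussianity of the critical 3D Ising model (clause (iii)); recorded to make the
open-problem status of the item precise (the `U₄` identity behind `ParityBound`: Duminil-Copin 2016
eq. (24), Aizenman–Duminil-Copin 2021 eq. (3.11); tree fact `ursellFour_eq_doubleCurrent`).
[cite: AizenmanDuminilCopinAnnals2021, eq. (3.11)] -/
theorem connectedFour_le_of_sourceTrailsMeet_of_parityBound :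
    SourceTrailsMeet → ParityBound →
    (let tetra : Fin 4 → Literature.Probability.LatticeModels.Site 3 := ![![-1, -1, -1], ![1, 1, -1], ![1, -1, 1], ![-1, 1, 1]]; ∃ c : ℝ, 0 < c ∧ ∀ l : ℕ, 1 ≤ l → ∃ N₀ : ℕ, ∀ N : ℕ, N₀ ≤ N → ∀ a : Fin 4 → ↥(Literature.Probability.LatticeModels.box 3 N), (∀ i, ((a i : Literature.Probability.LatticeModels.Site 3)) = (l : ℤ) • tetra i) → (let G := ((Literature.Probability.LatticeModels.zdGraph 3).comap (Subtype.val : ↥(Literature.Probability.LatticeModels.box 3 N) → Literature.Probability.LatticeModels.Site 3)); let φ := Literature.Probability.LatticeModels.rcMeasure G (Literature.Probability.LatticeModels.fkIsingParam (Literature.Probability.LatticeModels.criticalBeta 3)) 2 ∅; Literature.Probability.LatticeModels.connectedFour (Literature.Probability.LatticeModels.isingMeasure G Finset.univ (Literature.Probability.LatticeModels.criticalBeta 3) 0 .free) Literature.Probability.LatticeModels.spinAt a ≤ -(2 * c * (φ.real (Literature.Probability.Percolation.openConn (a 0) (a 1)) * φ.real (Literature.Probability.Percolation.openConn (a 2)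 (a 3)))))) := by
  intro hS hPB
  rw [sourceTrailsMeet_iff_fkMerged] at hS
  unfold ParityBound at hPB
  intro tetra
  obtain ⟨c, hc, hS⟩ := hS
  refine ⟨c, hc, fun l hl => ?_⟩
  obtain ⟨N₀, hS⟩ := hS l hl
  refine ⟨N₀, fun N hN a ha => ?_⟩
  have hainj : Function.Injective a := tetra_injective hl a ha
  have hβ : 0 ≤ criticalBeta 3 := criticalBeta_nonneg 3
  have hS := hS N hN a ha
  intro G φ
  have key : ∀ I : ℝ, c * φ.real (openConn (a 0) (a 1)) * φ.real (openConn (a 2) (a 3)) ≤ I →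
      connectedFour (isingMeasure G Finset.univ (criticalBeta 3) 0 .free) spinAt a ≤ -(2 * I) →
      connectedFour (isingMeasure G Finset.univ (criticalBeta 3) 0 .free) spinAt a ≤
        -(2 * c * (φ.real (openConn (a 0) (a 1)) * φ.real (openConn (a 2) (a 3)))) := by
    intro I h1 h2
    have h3 : 2 * (c * φ.real (openConn (a 0) (a 1)) * φ.real (openConn (a 2) (a 3))) ≤ 2 * I :=
      mul_le_mul_of_nonneg_left h1 two_pos.le
    calc connectedFour (isingMeasure G Finset.univ (criticalBeta 3) 0 .free) spinAt a
        ≤ -(2 * I) := h2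
      _ ≤ -(2 * c * (φ.real (openConn (a 0) (a 1)) * φ.real (openConn (a 2) (a 3)))) := by linarith
  exact key _ hS (hPB _ G (criticalBeta 3) hβ a hainj)

end Box

end Summit.CriticalPhenomena.Ising3DConformalLimit.Theorems

end
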